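import Summits.RiemannHypothesis.RiemannHypothesis.Theses.LiDirichletAsymptotic
import Summits.RiemannHypothesis.RiemannHypothesis.Theorems.LiDirichletAsymptoticBudgetCharBounds
import Summits.RiemannHypothesis.RiemannHypothesis.Theorems.WeilCombCombShapePositivityMertensLower
import HarnessLib

/-!
# RiemannHypothesis / LiDirichletAsymptotic — crux K4χ `LiBudgetChar`: the ERROR BUDGET (RH-FREE · GRH-FREE)

RH-FREE · GRH-FREE PROOF-OF-DATA (rung L-P(P1⁺χ)) [rh-li-prover].  Route `Theses/LiDirichletAsymptotic.lean`
(cell `pub/rh-li`, round 5 (iii)), item `LiBudgetChar` (stmt-RiemannHypothesis-19631): a closed real inequality in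
`(q, n, T)`, uniform in the conductor `q ≥ 2`: for `T ≥ 1000` and `n ≤ T²/4`,

* `n ≥ 10⁴`: `charErrFar q n T + charErrLowP q n + charErrSmooth q n + charErrOscP q n ≤ 15 √n log(qn)` (tree constants);
* `n ≥ 900`:  `charErrFar q n T + charErrLowB q n + charErrSmooth q n + charErrOscB q n ≤ √n log(qn)` (BMOR constants).

Proof (χ-transfer of the closed ζ item 19165 `LiAsymptoticBudget`): the helper
`Theorems/LiDirichletAsymptoticBudgetCharBounds.lean` bounds every piece LINEARLY in the atoms `s·u, s, u, L, log n, 1`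
(`s = √n`, `L = log q`, `u = L + (log n)/2`); the two budgets then close by `s ≥ 30`, `log n ≥ 6.75`, `log q ≥ 0.6931`
resp. `s ≥ 100`, `log n ≥ 9.2` (tree `WeilCombMertensLower.log_ten_pow_four_ge`) with `nlinarith` on the two products `s·L ≥ s₀·L`, `(s − s₀)((log n)/2 − λ₀) ≥ 0`
(in-seat float sup of budget/bound for the linearised majorants: 0.906 BMOR at `q = 2, n = 900`; 0.926 plain as
`q → ∞` at `n = 10⁴`; theory's exact interval sups 0.864 / 0.929, `HOME/theory/route/r5/et_r5b_interval.py`).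
Nothing here bears on the truth of RH or GRH.
-/

noncomputable section

-- D-0017: `Summit.<S>.<S>.…` is the designed namespace of a single-problem summit.
set_option linter.dupNamespace false

open Real Set

namespace Summit.RiemannHypothesis.RiemannHypothesis.Theorems.LiTheory

open Literature.NumberTheory.LFunctions

open BudgetChar

/-- **Crux K4χ `LiBudgetChar`** (stmt-RiemannHypothesis-19631; a closed real inequality, RH-FREE · GRH-FREE).
For `q ≥ 2`, `T ≥ 1000` and `n ≤ T²/4`:
`n ≥ 10⁴ ⇒ charErrFar q n T + charErrLowP q n + charErrSmooth q n + charErrOscP q n ≤ 15 √n log(qn)` and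
`n ≥ 900 ⇒ charErrFar q n T + charErrLowB q n + charErrSmooth q n + charErrOscB q n ≤ √n log(qn)`. -/
theorem liBudgetChar_bound (q : ℕ) (hq : 2 ≤ q) (n : ℕ) (T : ℝ) (hT : 1000 ≤ T)
    (hnc : (n : ℝ) ≤ 1 / 4 * T ^ 2) :
    (10000 ≤ n →
      charErrFar q n T + charErrLowP q n + charErrSmooth q n + charErrOscP q n ≤
        15 * Real.sqrt n * Real.log (q * n)) ∧
    (900 ≤ n →
      charErrFar q n T + charErrLowB q n + charErrSmooth q n + charErrOscB q n ≤
        Real.sqrt n * Real.log (q * n)) := by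
  have hT0 : 0 < T := by linarith
  have hqR : (2 : ℝ) ≤ q := by exact_mod_cast hq
  have hq0 : (0 : ℝ) < q := by linarith
  have hL0 : 0.6931 ≤ Real.log q :=
    le_trans (by linarith [Real.log_two_gt_d9]) (Real.log_le_log (by norm_num) hqR)
  -- common facts for `n ≥ 900`
  have key : ∀ (_ : 900 ≤ n), 30 ≤ Real.sqrt n ∧ 6.75 ≤ Real.log n ∧
      Real.log (q * n) = Real.log q + Real.log n ∧
      charErrFar q n T ≤ (0.0562 * Real.sqrt n + 0.0398) * (Real.log q + Real.log n / 2 + 0.6932) ∧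
      charCountMain q (Real.sqrt n) ≤ 0.3184 * Real.sqrt n * (Real.log q + Real.log n / 2 - 17 / 6) := by
    intro hn
    obtain ⟨hs30, -, -, hLn⟩ := sqrt_facts hn
    have hnR : (900 : ℝ) ≤ n := by exact_mod_cast hn
    refine ⟨hs30, hLn, ?_, charErrFar_le hq hn hnc hT0, charCountMain_le hq hn⟩
    rw [Real.log_mul hq0.ne' (by positivity)]
  constructor
  · intro hn
    have hn900 : 900 ≤ n := le_trans (by norm_num) hn
    obtain ⟨hs30, -, hlogqn, hfar, hccm⟩ := key hn900
    have hnR : (10000 : ℝ) ≤ n := by exact_mod_cast hn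
    have hs : 100 ≤ Real.sqrt n := by
      rw [show (100 : ℝ) = Real.sqrt (100 ^ 2) by rw [Real.sqrt_sq (by norm_num)]]
      exact Real.sqrt_le_sqrt (by linarith)
    have hLn : 9.2 ≤ Real.log n := WeilCombMertensLower.log_ten_pow_four_ge.trans (Real.log_le_log (by norm_num) hnR)
    have hA := argSRem_le hq hn
    have hosc := charErrOscP_le hq hn
    set s := Real.sqrt n
    set L := Real.log q
    set Ln := Real.log n
    rw [hlogqn]
    unfold charErrLowP charErrSmooth
    -- products
    have hP : 100 * L ≤ s * L := by nlinarith
    have hX : 0 ≤ (s - 100) * (Ln / 2 - 4.6) := mul_nonneg (by linarith) (by linarith)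
    nlinarith [hP, hX]
  · intro hn
    obtain ⟨hs30, hLn, hlogqn, hfar, hccm⟩ := key hn
    have hrem := bmorRem_le hq hn
    have hosc := charErrOscB_le hq hn
    set s := Real.sqrt n
    set L := Real.log q
    set Ln := Real.log n
    rw [hlogqn]
    unfold charErrLowB charErrSmooth
    have hP : 30 * L ≤ s * L := by nlinarith
    have hX : 0 ≤ (s - 30) * (Ln / 2 - 3.375) := mul_nonneg (by linarith) (by linarith)
    nlinarith [hP, hX]

/-- **Item `LiBudgetChar` of route `LiDirichletAsymptotic`** (stmt-RiemannHypothesis-19631), closed BY NAME. -/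
theorem liBudgetChar_proof :
    Summit.RiemannHypothesis.RiemannHypothesis.Theses.LiDirichletAsymptotic.LiBudgetChar :=
  fun q hq n T hT hnc ↦ liBudgetChar_bound q hq n T hT hnc

end Summit.RiemannHypothesis.RiemannHypothesis.Theorems.LiTheory

end
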